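import Summits.BirchSwinnertonDyer.BirchSwinnertonDyer.Theorems.ManinLocalTwoThreeNewformsFiftySix
import Summits.BirchSwinnertonDyer.BirchSwinnertonDyer.Theorems.ManinLocalTwoThreeEtaQuotientLowerUnipotent
import Literature.NumberTheory.ModularForms.EtaMultiplierRademacherPhi
import HarnessLib

/-!
# The Atkin–Lehner involution `W₇` on the `η`-quotients of level `56`: `η(δ·W₇τ) ∝ η(δ*τ)` factor by factor, hence
# `U∘W₇ = U`, `V∘W₇ = V`, `P|W₇ = −Q`, `Q|W₇ = −P` — by Dedekind's functional equation only

Cell bsd-f2-manin, route `ManinLocalTwoThree` (crux C2 `ManinOddAtFour`, stmt-22967: `2² ∣ 56`), prover seat p2 gen 28.  THE DEVICE that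
unblocks the second cusp of the fibre `X₀(56) → 56a1 ∋ O` (`{∞, 1/8}`, `1/8 = W₇∞`), recorded as a dead end by p2 g27 for `72`
(«needs `η(δ·γτ)` for `γ ∈ SL₂(ℤ)` with `δ ∤ c(γ)`»): NO fractional-linear `η`-arguments are needed, because AN ATKIN–LEHNER MATRIX
PERMUTES THE FACTORS `η(δτ)`.  Write `W₇ = A₀·β` with `A₀ = (1 0; 8 1) ∈ SL₂(ℤ)` (`A₀∞ = 1/8`) and `β : τ ↦ 7τ − 1`, i.e.
`W₇τ = A₀σ` for `σ = 7τ − 1`, `τ = (σ + 1)/7`.  For `δ = δ₁δ₂ ∣ 56` (`δ₁ ∣ 8`, `δ₂ ∣ 7`) put `δ* = δ₁·7/δ₂` and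
`M_δ = (δ₂, −δ₁; 8/δ₁, −7/δ₂) ∈ SL₂(ℤ)`; then `δ·A₀σ = M_δ(δ*τ)` in `ℍ` and `M_δ` has lower-left entry `8/δ₁ > 0`, so Dedekind's
functional equation (tree `eta_SL2_smul_rademacherPhi`) gives

  `η(δ·A₀σ) = e^{πi(Φ(M_δ) − 3)/12} · √((8σ+1)/δ₂) · η(δ*τ)`,  `Φ(M_δ) − 3 ∈ {−9, −6, −6, −9, 3, 0, 0, 3}` for `δ = 1, 2, 4, 8, 7, 14, 28, 56`

(§1–§2: `Φ` by the tree's Dedekind sums `s(1, c) = (c−1)(c−2)/(12c)`, `s(−h) = −s(h)`, `s(h + c) = s(h)`).  §3 assembles the four objects of the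
level-`56` programme (`EtaMonomialsFiftySix`): **`U(A₀σ) = U(τ)`, `V(A₀σ) = V(τ)`** (the 24th roots of unity and the square roots cancel
EXACTLY: `Σ r_δ(Φ_δ − 3) = 0` and `Σ_{δ₂ = 1} r_δ = Σ_{δ₂ = 7} r_δ = 0`), **`P(A₀σ) = −(8σ+1)²/7 · Q(τ)`, `Q(A₀σ) = −(8σ+1)²/7 · P(τ)`**
(`ζ₂₄⁻¹² = −1`; `56a = P − Q` has `W₇`-sign `+1`, `56b = P + Q` has `−1`).  Consequence (next files): every `W₇`-symmetric expression in
`U, V, P ± Q` behaves at the cusp `1/8` as at `∞` read in `τ = (σ+1)/7` — the `η`-identities of `X₀(56) → 56a1/56b1` need `q`-expansions AT `∞`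
ONLY.  Numerics: seat folder `scripts/level56.py`.  No definition, no named fact, no sorry; nothing here proves C2, Manin's conjecture or BSD. [cite: AtkinLehner1970, Lemma 7] [cite: Apostol1990, Thm. 3.4] [cite: RademacherGrosswald1972, Ch. 4 A, eq. (59)–(60)]
-/

set_option autoImplicit false
-- lint-debt: the directory name repeats the summit name (sibling precedent `ManinLocalTwoThreeEtaQuotientLowerUnipotent.lean`)
set_option linter.dupNamespace false

noncomputable section

open Complex Filter Topology Set Asymptotics
open UpperHalfPlane hiding I
open scoped Real Topology Manifold MatrixGroups ModularForm
open ModularForm CongruenceSubgroup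
open Literature.NumberTheory.ModularForms
open Literature.NumberTheory.EllipticCurves Literature.NumberTheory.EllipticCurves.ModularForms

namespace Summit.BirchSwinnertonDyer.BirchSwinnertonDyer.Theorems.ManinLocalTwoThree.AtkinLehnerEtaFiftySix

/-! ## §1 Rademacher's `Φ` at the eight matrices `M_δ` -/

/-- `Φ(1, b; c, −7) = −(6 + (c−1)(c−2))/c` for `c ∈ {1, 2, 4, 8}` (`−7 ≡ 1 (mod c)`, `s(1, c) = (c−1)(c−2)/(12c)`).
[cite: RademacherGrosswald1972, Ch. 4 A, eq. (59)] -/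
theorem rademacherPhi_one_negSeven (b : ℤ) (c : ℕ) (hc : 0 < c) (h7 : (-7 : ℤ) % c = 1 % c) :
    rademacherPhi 1 b c (-7) = -(6 + ((c : ℚ) - 1) * ((c : ℚ) - 2)) / c := by
  have hc0 : (c : ℤ) ≠ 0 := by exact_mod_cast hc.ne'
  have hcq : (c : ℚ) ≠ 0 := by exact_mod_cast hc.ne'
  rw [rademacherPhi_of_c_ne_zero hc0, Int.sign_natCast_of_ne_zero hc.ne', Int.natAbs_natCast,
    dedekindSum_congr_of_emod_eq h7, EtaQuotientLowerUnipotent.dedekindSum_one c hc]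
  push_cast
  field_simp
  ring

/-- `Φ(7, b; c, −1) = (6 + (c−1)(c−2))/c` for `c ≥ 1` (`s(−1, c) = −s(1, c)`). [cite: RademacherGrosswald1972, Ch. 4 A, eq. (59)] -/
theorem rademacherPhi_seven_negOne (b : ℤ) (c : ℕ) (hc : 0 < c) :
    rademacherPhi 7 b c (-1) = (6 + ((c : ℚ) - 1) * ((c : ℚ) - 2)) / c := by
  have hc0 : (c : ℤ) ≠ 0 := by exact_mod_cast hc.ne'
  have hcq : (c : ℚ) ≠ 0 := by exact_mod_cast hc.ne'
  rw [rademacherPhi_of_c_ne_zero hc0, Int.sign_natCast_of_ne_zero hc.ne', Int.natAbs_natCast,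
    dedekindSum_neg, EtaQuotientLowerUnipotent.dedekindSum_one c hc]
  push_cast
  field_simp
  ring

/-! ## §2 The Atkin–Lehner involution `W₇` at the cusp `1/8`: `η(δ·A₀σ)` in terms of `η(δ*·τ)`, `τ = (σ+1)/7` -/

/-- `8σ + 1 ≠ 0` on `ℍ`. [folklore] -/
theorem eight_mul_add_one_ne_zero (σ : ℍ) : (8 : ℂ) * σ + 1 ≠ 0 := by
  intro h
  have := congrArg Complex.im h
  simp at this
  exact absurd this σ.im_pos.ne'

/-- **The factors with `δ ∣ 8`**: for `A₀ = (1 0; 8 1)`, `δ ∣ 8`, `δ' = 7δ` and `τ = (σ + 1)/7`,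
`η(δ·A₀σ) = e^{πi(Φ(M) − 3)/12} √(8σ+1) η(δ'τ)` with `M = (1, −δ; 8/δ, −7) ∈ SL₂(ℤ)` (`δ·A₀σ = M(δ'τ)`; Dedekind's functional equation).
[cite: Apostol1990, Thm. 3.4] [cite: AtkinLehner1970, Lemma 7] -/
theorem eta_natMul_A0_smul (A : SL(2, ℤ)) (h00 : A 0 0 = 1) (h01 : A 0 1 = 0) (h10 : A 1 0 = 8) (h11 : A 1 1 = 1)
    (δ : ℕ) (hδ : δ ∣ 8) (δ' : ℕ) (hδ' : δ' = 7 * δ) (σ : ℍ) :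
    η ((δ : ℂ) * ((A • σ : ℍ) : ℂ))
      = cexp (π * I * (((rademacherPhi 1 (-(δ : ℤ)) ((8 / δ : ℕ) : ℤ) (-7) : ℚ) : ℂ) - 3) / 12)
        * Complex.sqrt ((8 : ℂ) * σ + 1) * η ((δ' : ℂ) * ((affPt 1 1 7 one_pos (by norm_num) σ : ℍ) : ℂ)) := by
  obtain ⟨e, he⟩ := hδ
  have hδpos : 0 < δ := Nat.pos_of_ne_zero (by rintro rfl; simp at he)
  have hepos : 0 < e := Nat.pos_of_ne_zero (by rintro rfl; simp at he)
  have h8e : 8 / δ = e := by rw [he, Nat.mul_div_cancel_left e hδpos]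
  have hδe : (δ : ℤ) * e = 8 := by exact_mod_cast he.symm
  let M : SL(2, ℤ) := ⟨!![1, -(δ : ℤ); (e : ℤ), -7], by
    rw [Matrix.det_fin_two_of]; linear_combination hδe⟩
  have hM00 : M 0 0 = 1 := rfl
  have hM01 : M 0 1 = -(δ : ℤ) := rfl
  have hM10 : M 1 0 = (e : ℤ) := rfl
  have hM11 : M 1 1 = -7 := rfl
  have hδ'pos : 0 < δ' := by rw [hδ']; positivity
  set τ : ℍ := affPt 1 1 7 one_pos (by norm_num) σ with hτ
  have hτc : (τ : ℂ) = ((σ : ℂ) + 1) / 7 := by rw [hτ, coe_affPt]; push_cast; ring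
  have hj := eight_mul_add_one_ne_zero σ
  -- the points: `δ·A₀σ = M(δ'τ)` and the automorphy factor `e·(δ'τ) − 7 = 8σ + 1`
  have hden : ((M 1 0 : ℤ) : ℂ) * ((natMulPt δ' hδ'pos τ : ℍ) : ℂ) + (M 1 1 : ℤ) = (8 : ℂ) * σ + 1 := by
    rw [hM10, hM11, coe_natMulPt, hτc, hδ']
    push_cast
    have : (e : ℂ) * δ = 8 := by exact_mod_cast (by rw [mul_comm]; exact he.symm : e * δ = 8)
    field_simp
    linear_combination ((σ : ℂ) + 1) * this
  have hpt : (δ : ℂ) * ((A • σ : ℍ) : ℂ) = ((M • natMulPt δ' hδ'pos τ : ℍ) : ℂ) := by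
    rw [coe_SL2_smul, coe_SL2_smul, h00, h01, h10, h11, hM00, hM01, hM10, hM11, coe_natMulPt, hτc, hδ']
    push_cast
    have : (e : ℂ) * δ = 8 := by exact_mod_cast (by rw [mul_comm]; exact he.symm : e * δ = 8)
    have hden' : (e : ℂ) * (7 * (δ : ℂ) * (((σ : ℂ) + 1) / 7)) + -7 = 8 * (σ : ℂ) + 1 := by
      field_simp
      linear_combination ((σ : ℂ) + 1) * this
    rw [hden']
    field_simp
    ring
  rw [hpt, eta_SL2_smul_rademacherPhi M (by rw [hM10]; exact_mod_cast hepos) (natMulPt δ' hδ'pos τ), hden,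
    rademacherPhiSL_apply, hM00, hM01, hM10, hM11, coe_natMulPt, h8e]

/-- **The factors with `7 ∣ δ`**: for `A₀ = (1 0; 8 1)`, `δ ∣ 8`, `δ' = 7δ` and `τ = (σ + 1)/7`,
`η(δ'·A₀σ) = e^{πi(Φ(M) − 3)/12} √((8σ+1)/7) η(δτ)` with `M = (7, −δ; 8/δ, −1) ∈ SL₂(ℤ)` (`δ'·A₀σ = M(δτ)`).
[cite: Apostol1990, Thm. 3.4] [cite: AtkinLehner1970, Lemma 7] -/
theorem eta_natMul_A0_smul' (A : SL(2, ℤ)) (h00 : A 0 0 = 1) (h01 : A 0 1 = 0) (h10 : A 1 0 = 8) (h11 : A 1 1 = 1)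
    (δ : ℕ) (hδ : δ ∣ 8) (δ' : ℕ) (hδ' : δ' = 7 * δ) (σ : ℍ) :
    η ((δ' : ℂ) * ((A • σ : ℍ) : ℂ))
      = cexp (π * I * (((rademacherPhi 7 (-(δ : ℤ)) ((8 / δ : ℕ) : ℤ) (-1) : ℚ) : ℂ) - 3) / 12)
        * Complex.sqrt (((8 : ℂ) * σ + 1) / 7) * η ((δ : ℂ) * ((affPt 1 1 7 one_pos (by norm_num) σ : ℍ) : ℂ)) := by
  obtain ⟨e, he⟩ := hδ
  have hδpos : 0 < δ := Nat.pos_of_ne_zero (by rintro rfl; simp at he)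
  have hepos : 0 < e := Nat.pos_of_ne_zero (by rintro rfl; simp at he)
  have h8e : 8 / δ = e := by rw [he, Nat.mul_div_cancel_left e hδpos]
  have hδe : (δ : ℤ) * e = 8 := by exact_mod_cast he.symm
  let M : SL(2, ℤ) := ⟨!![7, -(δ : ℤ); (e : ℤ), -1], by
    rw [Matrix.det_fin_two_of]; linear_combination hδe⟩
  have hM00 : M 0 0 = 7 := rfl
  have hM01 : M 0 1 = -(δ : ℤ) := rfl
  have hM10 : M 1 0 = (e : ℤ) := rfl
  have hM11 : M 1 1 = -1 := rfl
  set τ : ℍ := affPt 1 1 7 one_pos (by norm_num) σ with hτ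
  have hτc : (τ : ℂ) = ((σ : ℂ) + 1) / 7 := by rw [hτ, coe_affPt]; push_cast; ring
  have hj := eight_mul_add_one_ne_zero σ
  have hed : (e : ℂ) * δ = 8 := by exact_mod_cast (by rw [mul_comm]; exact he.symm : e * δ = 8)
  have hden : ((M 1 0 : ℤ) : ℂ) * ((natMulPt δ hδpos τ : ℍ) : ℂ) + (M 1 1 : ℤ) = ((8 : ℂ) * σ + 1) / 7 := by
    rw [hM10, hM11, coe_natMulPt, hτc]
    push_cast
    field_simp
    linear_combination ((σ : ℂ) + 1) * hed
  have hpt : (δ' : ℂ) * ((A • σ : ℍ) : ℂ) = ((M • natMulPt δ hδpos τ : ℍ) : ℂ) := by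
    rw [coe_SL2_smul, coe_SL2_smul, h00, h01, h10, h11, hM00, hM01, hM10, hM11, coe_natMulPt, hτc, hδ']
    push_cast
    have hden' : (e : ℂ) * ((δ : ℂ) * (((σ : ℂ) + 1) / 7)) + -1 = ((8 : ℂ) * σ + 1) / 7 := by
      field_simp
      linear_combination ((σ : ℂ) + 1) * hed
    rw [hden']
    field_simp
    ring
  rw [hpt, eta_SL2_smul_rademacherPhi M (by rw [hM10]; exact_mod_cast hepos) (natMulPt δ hδpos τ), hden,
    rademacherPhiSL_apply, hM00, hM01, hM10, hM11, coe_natMulPt, h8e]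

/-- The constant `e^{πi(Φ − 3)/12}` as a power of `ζ₂₄ = e^{πi/12}` when `Φ − 3 = k ∈ ℤ`. [folklore] -/
theorem cexp_rademacher_eq_zpow (Φ : ℚ) (k : ℤ) (h : Φ = k + 3) :
    cexp (π * I * ((Φ : ℂ) - 3) / 12) = cexp (π * I / 12) ^ k := by
  rw [← Complex.exp_int_mul, h]
  congr 1
  push_cast
  ring

section PerDivisor

variable (A : SL(2, ℤ)) (h00 : A 0 0 = 1) (h01 : A 0 1 = 0) (h10 : A 1 0 = 8) (h11 : A 1 1 = 1) (σ : ℍ)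
include h00 h01 h10 h11

/-- `η(2·A₀σ) = ζ₂₄⁻⁶ √(8σ+1) η(14τ)` (`Φ(1, −2; 4, −7) = −3`). [cite: AtkinLehner1970, Lemma 7] -/
theorem eta_two_A0 : η ((2 : ℕ) * ((A • σ : ℍ) : ℂ)) = cexp (π * I / 12) ^ (-6 : ℤ) * Complex.sqrt ((8 : ℂ) * σ + 1)
      * η ((14 : ℕ) * ((affPt 1 1 7 one_pos (by norm_num) σ : ℍ) : ℂ)) := by
  rw [eta_natMul_A0_smul A h00 h01 h10 h11 2 (by norm_num) 14 rfl σ,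
    cexp_rademacher_eq_zpow _ (-6) (by rw [rademacherPhi_one_negSeven _ _ (by norm_num) (by decide)]; norm_num)]

/-- `η(4·A₀σ) = ζ₂₄⁻⁶ √(8σ+1) η(28τ)` (`Φ(1, −4; 2, −7) = −3`). [cite: AtkinLehner1970, Lemma 7] -/
theorem eta_four_A0 : η ((4 : ℕ) * ((A • σ : ℍ) : ℂ)) = cexp (π * I / 12) ^ (-6 : ℤ) * Complex.sqrt ((8 : ℂ) * σ + 1)
      * η ((28 : ℕ) * ((affPt 1 1 7 one_pos (by norm_num) σ : ℍ) : ℂ)) := by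
  rw [eta_natMul_A0_smul A h00 h01 h10 h11 4 (by norm_num) 28 rfl σ,
    cexp_rademacher_eq_zpow _ (-6) (by rw [rademacherPhi_one_negSeven _ _ (by norm_num) (by decide)]; norm_num)]

/-- `η(8·A₀σ) = ζ₂₄⁻⁹ √(8σ+1) η(56τ)` (`Φ(1, −8; 1, −7) = −6`). [cite: AtkinLehner1970, Lemma 7] -/
theorem eta_eight_A0 : η ((8 : ℕ) * ((A • σ : ℍ) : ℂ)) = cexp (π * I / 12) ^ (-9 : ℤ) * Complex.sqrt ((8 : ℂ) * σ + 1)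
      * η ((56 : ℕ) * ((affPt 1 1 7 one_pos (by norm_num) σ : ℍ) : ℂ)) := by
  rw [eta_natMul_A0_smul A h00 h01 h10 h11 8 (by norm_num) 56 rfl σ,
    cexp_rademacher_eq_zpow _ (-9) (by rw [rademacherPhi_one_negSeven _ _ (by norm_num) (by decide)]; norm_num)]

/-- `η(1·A₀σ) = ζ₂₄⁻⁹ √(8σ+1) η(7τ)` (`Φ(1, −1; 8, −7) = −6`). [cite: AtkinLehner1970, Lemma 7] -/
theorem eta_one_A0 : η ((1 : ℕ) * ((A • σ : ℍ) : ℂ)) = cexp (π * I / 12) ^ (-9 : ℤ) * Complex.sqrt ((8 : ℂ) * σ + 1)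
      * η ((7 : ℕ) * ((affPt 1 1 7 one_pos (by norm_num) σ : ℍ) : ℂ)) := by
  rw [eta_natMul_A0_smul A h00 h01 h10 h11 1 (by norm_num) 7 rfl σ,
    cexp_rademacher_eq_zpow _ (-9) (by rw [rademacherPhi_one_negSeven _ _ (by norm_num) (by decide)]; norm_num)]

/-- `η(14·A₀σ) = √((8σ+1)/7) η(2τ)` (`Φ(7, −2; 4, −1) = 3`). [cite: AtkinLehner1970, Lemma 7] -/
theorem eta_fourteen_A0 : η ((14 : ℕ) * ((A • σ : ℍ) : ℂ)) = cexp (π * I / 12) ^ (0 : ℤ) * Complex.sqrt (((8 : ℂ) * σ + 1) / 7)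
      * η ((2 : ℕ) * ((affPt 1 1 7 one_pos (by norm_num) σ : ℍ) : ℂ)) := by
  rw [eta_natMul_A0_smul' A h00 h01 h10 h11 2 (by norm_num) 14 rfl σ,
    cexp_rademacher_eq_zpow _ 0 (by rw [rademacherPhi_seven_negOne _ _ (by norm_num)]; norm_num)]

/-- `η(28·A₀σ) = √((8σ+1)/7) η(4τ)` (`Φ(7, −4; 2, −1) = 3`). [cite: AtkinLehner1970, Lemma 7] -/
theorem eta_twentyEight_A0 : η ((28 : ℕ) * ((A • σ : ℍ) : ℂ)) = cexp (π * I / 12) ^ (0 : ℤ) * Complex.sqrt (((8 : ℂ) * σ + 1) / 7)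
      * η ((4 : ℕ) * ((affPt 1 1 7 one_pos (by norm_num) σ : ℍ) : ℂ)) := by
  rw [eta_natMul_A0_smul' A h00 h01 h10 h11 4 (by norm_num) 28 rfl σ,
    cexp_rademacher_eq_zpow _ 0 (by rw [rademacherPhi_seven_negOne _ _ (by norm_num)]; norm_num)]

/-- `η(56·A₀σ) = ζ₂₄³ √((8σ+1)/7) η(8τ)` (`Φ(7, −8; 1, −1) = 6`). [cite: AtkinLehner1970, Lemma 7] -/
theorem eta_fiftySix_A0 : η ((56 : ℕ) * ((A • σ : ℍ) : ℂ)) = cexp (π * I / 12) ^ (3 : ℤ) * Complex.sqrt (((8 : ℂ) * σ + 1) / 7)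
      * η ((8 : ℕ) * ((affPt 1 1 7 one_pos (by norm_num) σ : ℍ) : ℂ)) := by
  rw [eta_natMul_A0_smul' A h00 h01 h10 h11 8 (by norm_num) 56 rfl σ,
    cexp_rademacher_eq_zpow _ 3 (by rw [rademacherPhi_seven_negOne _ _ (by norm_num)]; norm_num)]

/-- `η(7·A₀σ) = ζ₂₄³ √((8σ+1)/7) η(τ)` (`Φ(7, −1; 8, −1) = 6`). [cite: AtkinLehner1970, Lemma 7] -/
theorem eta_seven_A0 : η ((7 : ℕ) * ((A • σ : ℍ) : ℂ)) = cexp (π * I / 12) ^ (3 : ℤ) * Complex.sqrt (((8 : ℂ) * σ + 1) / 7)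
      * η ((1 : ℕ) * ((affPt 1 1 7 one_pos (by norm_num) σ : ℍ) : ℂ)) := by
  rw [eta_natMul_A0_smul' A h00 h01 h10 h11 1 (by norm_num) 7 rfl σ,
    cexp_rademacher_eq_zpow _ 3 (by rw [rademacherPhi_seven_negOne _ _ (by norm_num)]; norm_num)]

/-! ## §3 The four objects of the level-`56` programme under `W₇`: `U∘W₇ = U`, `V∘W₇ = V`, `P|W₇ = −Q`, `Q|W₇ = −P` -/

/-- **`U(A₀σ) = U((σ+1)/7)`** for `U = η₄³η₂₈³/(η₂η₈²η₁₄η₅₆²)` (`x + 1` on `56a1`): `U` is `W₇`-invariant, and the `q`-expansion of `U` at the cusp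
`1/8 = W₇∞` (width `7`) is that at `∞` read in `q₇ζ₇`. [cite: AtkinLehner1970, Lemma 7] -/
theorem U_A0_smul : etaQuotient 56 (expFn [(2, -1), (4, 3), (8, -2), (14, -1), (28, 3), (56, -2)]) (A • σ)
    = etaQuotient 56 (expFn [(2, -1), (4, 3), (8, -2), (14, -1), (28, 3), (56, -2)]) (affPt 1 1 7 one_pos (by norm_num) σ) := by
  set τ : ℍ := affPt 1 1 7 one_pos (by norm_num) σ with hτ
  have hζ : cexp (π * I / 12) ≠ 0 := Complex.exp_ne_zero _
  have hj := eight_mul_add_one_ne_zero σ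
  have hs : Complex.sqrt ((8 : ℂ) * σ + 1) ≠ 0 := fun h ↦ hj (by rw [← csqrt_sq ((8 : ℂ) * σ + 1), h]; ring)
  have ht : Complex.sqrt (((8 : ℂ) * σ + 1) / 7) ≠ 0 := fun h ↦ hj (by
    have := csqrt_sq (((8 : ℂ) * σ + 1) / 7); rw [h] at this; linear_combination (-7 : ℂ) * this)
  have hη : ∀ d : ℕ, 0 < d → η ((d : ℂ) * (τ : ℂ)) ≠ 0 := fun d hd ↦ eta_natMul_ne_zero hd τ.im_pos
  have := hη 2 (by norm_num); have := hη 4 (by norm_num); have := hη 8 (by norm_num)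
  have := hη 14 (by norm_num); have := hη 28 (by norm_num); have := hη 56 (by norm_num)
  rw [etaQuotient_apply, etaQuotient_apply, show Nat.divisors 56 = {1, 2, 4, 7, 8, 14, 28, 56} by decide]
  repeat rw [Finset.prod_insert (by decide)]
  rw [Finset.prod_singleton, Finset.prod_singleton]
  rw [show expFn [(2, -1), (4, 3), (8, -2), (14, -1), (28, 3), (56, -2)] 1 = 0 by decide,
    show expFn [(2, -1), (4, 3), (8, -2), (14, -1), (28, 3), (56, -2)] 2 = (-1) by decide,
    show expFn [(2, -1), (4, 3), (8, -2), (14, -1), (28, 3), (56, -2)] 4 = 3 by decide,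
    show expFn [(2, -1), (4, 3), (8, -2), (14, -1), (28, 3), (56, -2)] 7 = 0 by decide,
    show expFn [(2, -1), (4, 3), (8, -2), (14, -1), (28, 3), (56, -2)] 8 = (-2) by decide,
    show expFn [(2, -1), (4, 3), (8, -2), (14, -1), (28, 3), (56, -2)] 14 = (-1) by decide,
    show expFn [(2, -1), (4, 3), (8, -2), (14, -1), (28, 3), (56, -2)] 28 = 3 by decide,
    show expFn [(2, -1), (4, 3), (8, -2), (14, -1), (28, 3), (56, -2)] 56 = (-2) by decide]
  simp only [zpow_zero, one_mul]
  rw [eta_two_A0 A h00 h01 h10 h11 σ, eta_four_A0 A h00 h01 h10 h11 σ, eta_eight_A0 A h00 h01 h10 h11 σ,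
    eta_fourteen_A0 A h00 h01 h10 h11 σ, eta_twentyEight_A0 A h00 h01 h10 h11 σ, eta_fiftySix_A0 A h00 h01 h10 h11 σ, ← hτ]
  simp only [zpow_neg, zpow_ofNat, mul_pow, inv_pow]
  field_simp

/-- **`V(A₀σ) = V((σ+1)/7)`** for `V = η₂²η₄η₁₄²η₂₈/(η₁η₇η₈²η₅₆²)` (`y + x + 1` on `56a1`): `V` is `W₇`-invariant. [cite: AtkinLehner1970, Lemma 7] -/
theorem V_A0_smul : etaQuotient 56 (expFn [(1, -1), (2, 2), (4, 1), (7, -1), (8, -2), (14, 2), (28, 1), (56, -2)]) (A • σ)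
    = etaQuotient 56 (expFn [(1, -1), (2, 2), (4, 1), (7, -1), (8, -2), (14, 2), (28, 1), (56, -2)])
        (affPt 1 1 7 one_pos (by norm_num) σ) := by
  set τ : ℍ := affPt 1 1 7 one_pos (by norm_num) σ with hτ
  have hζ : cexp (π * I / 12) ≠ 0 := Complex.exp_ne_zero _
  have hj := eight_mul_add_one_ne_zero σ
  have hs : Complex.sqrt ((8 : ℂ) * σ + 1) ≠ 0 := fun h ↦ hj (by rw [← csqrt_sq ((8 : ℂ) * σ + 1), h]; ring)
  have ht : Complex.sqrt (((8 : ℂ) * σ + 1) / 7) ≠ 0 := fun h ↦ hj (by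
    have := csqrt_sq (((8 : ℂ) * σ + 1) / 7); rw [h] at this; linear_combination (-7 : ℂ) * this)
  have hη : ∀ d : ℕ, 0 < d → η ((d : ℂ) * (τ : ℂ)) ≠ 0 := fun d hd ↦ eta_natMul_ne_zero hd τ.im_pos
  have := hη 1 one_pos; have := hη 2 (by norm_num); have := hη 4 (by norm_num); have := hη 7 (by norm_num)
  have := hη 8 (by norm_num); have := hη 14 (by norm_num); have := hη 28 (by norm_num); have := hη 56 (by norm_num)
  rw [etaQuotient_apply, etaQuotient_apply, show Nat.divisors 56 = {1, 2, 4, 7, 8, 14, 28, 56} by decide]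
  repeat rw [Finset.prod_insert (by decide)]
  rw [Finset.prod_singleton, Finset.prod_singleton]
  rw [show expFn [(1, -1), (2, 2), (4, 1), (7, -1), (8, -2), (14, 2), (28, 1), (56, -2)] 1 = (-1) by decide,
    show expFn [(1, -1), (2, 2), (4, 1), (7, -1), (8, -2), (14, 2), (28, 1), (56, -2)] 2 = 2 by decide,
    show expFn [(1, -1), (2, 2), (4, 1), (7, -1), (8, -2), (14, 2), (28, 1), (56, -2)] 4 = 1 by decide,
    show expFn [(1, -1), (2, 2), (4, 1), (7, -1), (8, -2), (14, 2), (28, 1), (56, -2)] 7 = (-1) by decide,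
    show expFn [(1, -1), (2, 2), (4, 1), (7, -1), (8, -2), (14, 2), (28, 1), (56, -2)] 8 = (-2) by decide,
    show expFn [(1, -1), (2, 2), (4, 1), (7, -1), (8, -2), (14, 2), (28, 1), (56, -2)] 14 = 2 by decide,
    show expFn [(1, -1), (2, 2), (4, 1), (7, -1), (8, -2), (14, 2), (28, 1), (56, -2)] 28 = 1 by decide,
    show expFn [(1, -1), (2, 2), (4, 1), (7, -1), (8, -2), (14, 2), (28, 1), (56, -2)] 56 = (-2) by decide]
  rw [eta_one_A0 A h00 h01 h10 h11 σ, eta_two_A0 A h00 h01 h10 h11 σ, eta_four_A0 A h00 h01 h10 h11 σ,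
    eta_seven_A0 A h00 h01 h10 h11 σ, eta_eight_A0 A h00 h01 h10 h11 σ, eta_fourteen_A0 A h00 h01 h10 h11 σ,
    eta_twentyEight_A0 A h00 h01 h10 h11 σ, eta_fiftySix_A0 A h00 h01 h10 h11 σ, ← hτ]
  simp only [zpow_neg, zpow_ofNat, mul_pow, inv_pow]
  field_simp

/-- Pair law: `η(2A₀σ)⁻¹η(4A₀σ)³ = −(8σ+1)·η(14τ)⁻¹η(28τ)³` (`ζ₂₄⁻¹² = −1`, `√(8σ+1)² = 8σ+1`). [cite: AtkinLehner1970, Lemma 7] -/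
theorem eta_pair_two_four_A0 : (η ((2 : ℕ) * ((A • σ : ℍ) : ℂ)))⁻¹ * η ((4 : ℕ) * ((A • σ : ℍ) : ℂ)) ^ 3
    = -((8 : ℂ) * σ + 1) * ((η ((14 : ℕ) * ((affPt 1 1 7 one_pos (by norm_num) σ : ℍ) : ℂ)))⁻¹
      * η ((28 : ℕ) * ((affPt 1 1 7 one_pos (by norm_num) σ : ℍ) : ℂ)) ^ 3) := by
  have hζ : cexp (π * I / 12) ≠ 0 := Complex.exp_ne_zero _
  have hζ12 : cexp (π * I / 12) ^ 12 = -1 := by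
    rw [← Complex.exp_nat_mul, show ((12 : ℕ) : ℂ) * (π * I / 12) = π * I by push_cast; ring, Complex.exp_pi_mul_I]
  have hj := eight_mul_add_one_ne_zero σ
  have hs2 := csqrt_sq ((8 : ℂ) * σ + 1)
  have hs : Complex.sqrt ((8 : ℂ) * σ + 1) ≠ 0 := fun h ↦ hj (by rw [← hs2, h]; ring)
  rw [eta_two_A0 A h00 h01 h10 h11 σ, eta_four_A0 A h00 h01 h10 h11 σ]
  simp only [zpow_neg, zpow_ofNat]
  rw [show ∀ (z s a b : ℂ), z ≠ 0 → s ≠ 0 → (z⁻¹ * s * a)⁻¹ * (z⁻¹ * s * b) ^ 3 = (z ^ 2)⁻¹ * s ^ 2 * (a⁻¹ * b ^ 3) from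
    fun z s a b hz hs ↦ by field_simp, ← pow_mul, show 6 * 2 = 12 by rfl, hζ12, hs2]
  · ring
  · exact pow_ne_zero _ hζ
  · exact hs

/-- Pair law: `η(2A₀σ)³η(4A₀σ)⁻¹ = −(8σ+1)·η(14τ)³η(28τ)⁻¹`. [cite: AtkinLehner1970, Lemma 7] -/
theorem eta_pair_two_four_A0' : η ((2 : ℕ) * ((A • σ : ℍ) : ℂ)) ^ 3 * (η ((4 : ℕ) * ((A • σ : ℍ) : ℂ)))⁻¹
    = -((8 : ℂ) * σ + 1) * (η ((14 : ℕ) * ((affPt 1 1 7 one_pos (by norm_num) σ : ℍ) : ℂ)) ^ 3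
      * (η ((28 : ℕ) * ((affPt 1 1 7 one_pos (by norm_num) σ : ℍ) : ℂ)))⁻¹) := by
  have hζ : cexp (π * I / 12) ≠ 0 := Complex.exp_ne_zero _
  have hζ12 : cexp (π * I / 12) ^ 12 = -1 := by
    rw [← Complex.exp_nat_mul, show ((12 : ℕ) : ℂ) * (π * I / 12) = π * I by push_cast; ring, Complex.exp_pi_mul_I]
  have hj := eight_mul_add_one_ne_zero σ
  have hs2 := csqrt_sq ((8 : ℂ) * σ + 1)
  have hs : Complex.sqrt ((8 : ℂ) * σ + 1) ≠ 0 := fun h ↦ hj (by rw [← hs2, h]; ring)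
  rw [eta_two_A0 A h00 h01 h10 h11 σ, eta_four_A0 A h00 h01 h10 h11 σ]
  simp only [zpow_neg, zpow_ofNat]
  rw [show ∀ (z s a b : ℂ), z ≠ 0 → s ≠ 0 → (z⁻¹ * s * a) ^ 3 * (z⁻¹ * s * b)⁻¹ = (z ^ 2)⁻¹ * s ^ 2 * (a ^ 3 * b⁻¹) from
    fun z s a b hz hs ↦ by field_simp, ← pow_mul, show 6 * 2 = 12 by rfl, hζ12, hs2]
  · ring
  · exact pow_ne_zero _ hζ
  · exact hs

/-- Pair law: `η(14A₀σ)³η(28A₀σ)⁻¹ = (8σ+1)/7·η(2τ)³η(4τ)⁻¹` (`√((8σ+1)/7)² = (8σ+1)/7`). [cite: AtkinLehner1970, Lemma 7] -/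
theorem eta_pair_fourteen_twentyEight_A0 : η ((14 : ℕ) * ((A • σ : ℍ) : ℂ)) ^ 3 * (η ((28 : ℕ) * ((A • σ : ℍ) : ℂ)))⁻¹
    = ((8 : ℂ) * σ + 1) / 7 * (η ((2 : ℕ) * ((affPt 1 1 7 one_pos (by norm_num) σ : ℍ) : ℂ)) ^ 3
      * (η ((4 : ℕ) * ((affPt 1 1 7 one_pos (by norm_num) σ : ℍ) : ℂ)))⁻¹) := by
  have hj := eight_mul_add_one_ne_zero σ
  have ht2 := csqrt_sq (((8 : ℂ) * σ + 1) / 7)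
  have ht : Complex.sqrt (((8 : ℂ) * σ + 1) / 7) ≠ 0 := fun h ↦ hj (by rw [h] at ht2; linear_combination (-7 : ℂ) * ht2)
  rw [eta_fourteen_A0 A h00 h01 h10 h11 σ, eta_twentyEight_A0 A h00 h01 h10 h11 σ]
  simp only [zpow_zero, one_mul]
  rw [show ∀ (t a b : ℂ), t ≠ 0 → (t * a) ^ 3 * (t * b)⁻¹ = t ^ 2 * (a ^ 3 * b⁻¹) from fun t a b ht ↦ by field_simp, ht2]
  exact ht

/-- Pair law: `η(14A₀σ)⁻¹η(28A₀σ)³ = (8σ+1)/7·η(2τ)⁻¹η(4τ)³`. [cite: AtkinLehner1970, Lemma 7] -/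
theorem eta_pair_fourteen_twentyEight_A0' : (η ((14 : ℕ) * ((A • σ : ℍ) : ℂ)))⁻¹ * η ((28 : ℕ) * ((A • σ : ℍ) : ℂ)) ^ 3
    = ((8 : ℂ) * σ + 1) / 7 * ((η ((2 : ℕ) * ((affPt 1 1 7 one_pos (by norm_num) σ : ℍ) : ℂ)))⁻¹
      * η ((4 : ℕ) * ((affPt 1 1 7 one_pos (by norm_num) σ : ℍ) : ℂ)) ^ 3) := by
  have hj := eight_mul_add_one_ne_zero σ
  have ht2 := csqrt_sq (((8 : ℂ) * σ + 1) / 7)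
  have ht : Complex.sqrt (((8 : ℂ) * σ + 1) / 7) ≠ 0 := fun h ↦ hj (by rw [h] at ht2; linear_combination (-7 : ℂ) * ht2)
  rw [eta_fourteen_A0 A h00 h01 h10 h11 σ, eta_twentyEight_A0 A h00 h01 h10 h11 σ]
  simp only [zpow_zero, one_mul]
  rw [show ∀ (t a b : ℂ), t ≠ 0 → (t * a)⁻¹ * (t * b) ^ 3 = t ^ 2 * (a⁻¹ * b ^ 3) from fun t a b ht ↦ by field_simp, ht2]
  exact ht

/-- **`P(A₀σ) = −(8σ+1)²/7 · Q((σ+1)/7)`** for `P = η₄³η₁₄³/(η₂η₂₈)`, `Q = η₂³η₂₈³/(η₄η₁₄)`: `W₇` swaps the two `η`-quotient cusp forms of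
level `56`, with the sign `−1` (so `56a = P − Q` has `W₇`-eigenvalue `+1` and `56b = P + Q` has `−1`). [cite: AtkinLehner1970, Lemma 7, Thm. 3] -/
theorem P_A0_smul : etaQuotient 56 (expFn [(2, -1), (4, 3), (14, 3), (28, -1)]) (A • σ)
    = -(((8 : ℂ) * σ + 1) ^ 2 / 7) * etaQuotient 56 (expFn [(2, 3), (4, -1), (14, -1), (28, 3)]) (affPt 1 1 7 one_pos (by norm_num) σ) := by
  set τ : ℍ := affPt 1 1 7 one_pos (by norm_num) σ with hτ
  have hη : ∀ d : ℕ, 0 < d → η ((d : ℂ) * (τ : ℂ)) ≠ 0 := fun d hd ↦ eta_natMul_ne_zero hd τ.im_pos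
  have e2 := hη 2 (by norm_num); have e4 := hη 4 (by norm_num); have e14 := hη 14 (by norm_num); have e28 := hη 28 (by norm_num)
  have L1 := eta_pair_two_four_A0 A h00 h01 h10 h11 σ
  have L2 := eta_pair_fourteen_twentyEight_A0 A h00 h01 h10 h11 σ
  rw [← hτ] at L1 L2
  rw [etaQuotient_apply, etaQuotient_apply, show Nat.divisors 56 = {1, 2, 4, 7, 8, 14, 28, 56} by decide]
  repeat rw [Finset.prod_insert (by decide)]
  rw [Finset.prod_singleton, Finset.prod_singleton]
  rw [show expFn [(2, -1), (4, 3), (14, 3), (28, -1)] 1 = 0 by decide, show expFn [(2, -1), (4, 3), (14, 3), (28, -1)] 2 = (-1) by decide,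
    show expFn [(2, -1), (4, 3), (14, 3), (28, -1)] 4 = 3 by decide, show expFn [(2, -1), (4, 3), (14, 3), (28, -1)] 7 = 0 by decide,
    show expFn [(2, -1), (4, 3), (14, 3), (28, -1)] 8 = 0 by decide, show expFn [(2, -1), (4, 3), (14, 3), (28, -1)] 14 = 3 by decide,
    show expFn [(2, -1), (4, 3), (14, 3), (28, -1)] 28 = (-1) by decide, show expFn [(2, -1), (4, 3), (14, 3), (28, -1)] 56 = 0 by decide,
    show expFn [(2, 3), (4, -1), (14, -1), (28, 3)] 1 = 0 by decide, show expFn [(2, 3), (4, -1), (14, -1), (28, 3)] 2 = 3 by decide,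
    show expFn [(2, 3), (4, -1), (14, -1), (28, 3)] 4 = (-1) by decide, show expFn [(2, 3), (4, -1), (14, -1), (28, 3)] 7 = 0 by decide,
    show expFn [(2, 3), (4, -1), (14, -1), (28, 3)] 8 = 0 by decide, show expFn [(2, 3), (4, -1), (14, -1), (28, 3)] 14 = (-1) by decide,
    show expFn [(2, 3), (4, -1), (14, -1), (28, 3)] 28 = 3 by decide, show expFn [(2, 3), (4, -1), (14, -1), (28, 3)] 56 = 0 by decide]
  simp only [zpow_neg, zpow_ofNat, pow_zero, pow_one, one_mul, mul_one]
  rw [show ∀ a b c d : ℂ, a * (b * (c * d)) = (a * b) * (c * d) from fun a b c d ↦ by ring, L1, L2]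
  field_simp

/-- **`Q(A₀σ) = −(8σ+1)²/7 · P((σ+1)/7)`.** [cite: AtkinLehner1970, Lemma 7, Thm. 3] -/
theorem Q_A0_smul : etaQuotient 56 (expFn [(2, 3), (4, -1), (14, -1), (28, 3)]) (A • σ)
    = -(((8 : ℂ) * σ + 1) ^ 2 / 7) * etaQuotient 56 (expFn [(2, -1), (4, 3), (14, 3), (28, -1)]) (affPt 1 1 7 one_pos (by norm_num) σ) := by
  set τ : ℍ := affPt 1 1 7 one_pos (by norm_num) σ with hτ
  have hη : ∀ d : ℕ, 0 < d → η ((d : ℂ) * (τ : ℂ)) ≠ 0 := fun d hd ↦ eta_natMul_ne_zero hd τ.im_pos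
  have e2 := hη 2 (by norm_num); have e4 := hη 4 (by norm_num); have e14 := hη 14 (by norm_num); have e28 := hη 28 (by norm_num)
  have L1 := eta_pair_two_four_A0' A h00 h01 h10 h11 σ
  have L2 := eta_pair_fourteen_twentyEight_A0' A h00 h01 h10 h11 σ
  rw [← hτ] at L1 L2
  rw [etaQuotient_apply, etaQuotient_apply, show Nat.divisors 56 = {1, 2, 4, 7, 8, 14, 28, 56} by decide]
  repeat rw [Finset.prod_insert (by decide)]
  rw [Finset.prod_singleton, Finset.prod_singleton]
  rw [show expFn [(2, -1), (4, 3), (14, 3), (28, -1)] 1 = 0 by decide, show expFn [(2, -1), (4, 3), (14, 3), (28, -1)] 2 = (-1) by decide,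
    show expFn [(2, -1), (4, 3), (14, 3), (28, -1)] 4 = 3 by decide, show expFn [(2, -1), (4, 3), (14, 3), (28, -1)] 7 = 0 by decide,
    show expFn [(2, -1), (4, 3), (14, 3), (28, -1)] 8 = 0 by decide, show expFn [(2, -1), (4, 3), (14, 3), (28, -1)] 14 = 3 by decide,
    show expFn [(2, -1), (4, 3), (14, 3), (28, -1)] 28 = (-1) by decide, show expFn [(2, -1), (4, 3), (14, 3), (28, -1)] 56 = 0 by decide,
    show expFn [(2, 3), (4, -1), (14, -1), (28, 3)] 1 = 0 by decide, show expFn [(2, 3), (4, -1), (14, -1), (28, 3)] 2 = 3 by decide,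
    show expFn [(2, 3), (4, -1), (14, -1), (28, 3)] 4 = (-1) by decide, show expFn [(2, 3), (4, -1), (14, -1), (28, 3)] 7 = 0 by decide,
    show expFn [(2, 3), (4, -1), (14, -1), (28, 3)] 8 = 0 by decide, show expFn [(2, 3), (4, -1), (14, -1), (28, 3)] 14 = (-1) by decide,
    show expFn [(2, 3), (4, -1), (14, -1), (28, 3)] 28 = 3 by decide, show expFn [(2, 3), (4, -1), (14, -1), (28, 3)] 56 = 0 by decide]
  simp only [zpow_neg, zpow_ofNat, pow_zero, pow_one, one_mul, mul_one]
  rw [show ∀ a b c d : ℂ, a * (b * (c * d)) = (a * b) * (c * d) from fun a b c d ↦ by ring, L1, L2]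
  field_simp

end PerDivisor

end Summit.BirchSwinnertonDyer.BirchSwinnertonDyer.Theorems.ManinLocalTwoThree.AtkinLehnerEtaFiftySix

end
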